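import Literature.NumberTheory.EllipticCurves.TorsionStructureProofs
import Literature.NumberTheory.EllipticCurves.TwoTorsionCardProofs
import Mathlib.GroupTheory.Perm.Sign
import HarnessLib

/-!
# The Galois action on `E[2]` as permutations of the three nonzero `2`-torsion points (proofs only)

`Proofs`-style helper layer (theorems and bookkeeping definitions only: no named fact, no instance;
D-0014/D-0026) for `TwoAdicImageSurjectivityModTwoProofs` (Dokchitser–Dokchitser 2012, Theorem,
clause (1): `ρ̄_{E,2}` onto iff no rational point of order `2` and `Δ ∉ K^{×2}`). For an elliptic
curve `W` over a field `K` with `2 ≠ 0`: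

* §1 kernel-decidable bookkeeping on the three nonzero vectors of `(ℤ/2)²`;
* §2 the abscissa `xco : E(K̄) → K̄`, `x(σP) = σ x(P)` (`xco_smul`), abscissae of points killed by `2`
  are roots of Mathlib's `2`-division cubic `WeierstrassCurve.twoTorsionPolynomial`
  (`4x³ + b₂x² + 2b₄x + b₆`; tree theorem `isRoot_twoTorsionPolynomial_of_add_self_eq_zero`), and a
  point killed by `2` is determined by its abscissa (`eq_of_xco_eq`);
* §3 a frame `E[2] ≅ (ℤ/2)²` (tree theorem `nonempty_geomTorsion_addEquiv_prod`, Silverman *AEC*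
  III.6.4(b)), the letters `T₀, T₁, T₂ = T₀ + T₁` (`E[2] = {O, T₀, T₁, T₂}`), the INJECTIVE and
  multiplicative map `perm : (E[2] ≃+ E[2]) → S₃`, the permutation `permGal σ` induced by
  `σ ∈ Γ_K` (`σ T_i = T_{permGal σ i}`, multiplicative in `σ`), and two explicit automorphisms
  (`swapAut : T₀ ↔ T₁`, `shearAut : T₀ ↔ T₂`) showing every nonzero `Q ∈ E[2]` is moved by some
  automorphism; the abscissae `x_i = x(T_i)` (distinct; `σ x_i = x_{permGal σ i}`) and
  `δ = (x₀ - x₁)(x₀ - x₂)(x₁ - x₂) ≠ 0` with `σ δ = sign(permGal σ) · δ` ("`ℚ(E[2]) ⊃ ℚ(√Δ)`").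

## References

* [SilvermanAEC2009] J. H. Silverman, *The Arithmetic of Elliptic Curves*, 2nd ed., GTM 106
  (2009), III.2 (group law, `2`-torsion), III.6.4(b) (`E[m] ≅ (ℤ/m)²`), III.7 (`ρ̄_{E,m}`), VIII.1.
* [DokchitserDokchitserMathZ2012] T. Dokchitser, V. Dokchitser, Math. Z. 272 (2012) 961–964,
  proof of the Theorem, first paragraph (the `2`-torsion points and the cubic).
-/

set_option autoImplicit false

/-! ### §1. The three nonzero vectors of `(ℤ/2)²` and the six permutations of three letters -/

namespace Literature.NumberTheory.EllipticCurves.DokchitserDokchitser2012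

/-- Every permutation of three letters is one of the six. [folklore] -/
private theorem perm_three_cases :
    ∀ g : Equiv.Perm (Fin 3), g = 1 ∨ g = Equiv.swap 0 1 ∨ g = Equiv.swap 0 2 ∨ g = Equiv.swap 1 2 ∨
      g = Equiv.swap 0 1 * Equiv.swap 0 2 ∨ g = Equiv.swap 0 2 * Equiv.swap 0 1 := by
  decide


/-- The nonzero vectors of `(ℤ/2)²`, indexed by three letters: `v₀ = (1,0)`, `v₁ = (0,1)`,
`v₂ = (1,1)` (bookkeeping abbreviation, no mathematical content). [folklore] -/
abbrev vec : Fin 3 → ZMod 2 × ZMod 2 := ![(1, 0), (0, 1), (1, 1)]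

/-- The index of a nonzero vector of `(ℤ/2)²` (junk value `0` at the zero vector; bookkeeping
abbreviation). [folklore] -/
abbrev idx : ZMod 2 × ZMod 2 → Fin 3 := fun w ↦ if w = (1, 0) then 0 else if w = (0, 1) then 1 else
  if w = (1, 1) then 2 else 0

/-- The three nonzero vectors of `(ℤ/2)²` are distinct. [folklore] -/
private theorem vec_injective : Function.Injective vec := by decide

/-- The three vectors `v_i` are nonzero. [folklore] -/
private theorem vec_ne_zero : ∀ i : Fin 3, vec i ≠ 0 := by decide

/-- `idx` inverts `vec` on nonzero vectors. [folklore] -/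
private theorem vec_idx : ∀ w : ZMod 2 × ZMod 2, w ≠ 0 → vec (idx w) = w := by decide

/-- `(ℤ/2)² = {0, v₀, v₁, v₂}`. [folklore] -/
private theorem eq_zero_or_eq_vec : ∀ w : ZMod 2 × ZMod 2, w = 0 ∨ ∃ i : Fin 3, w = vec i := by decide

/-- `v₂ = v₀ + v₁`. [folklore] -/
private theorem vec_two : vec 2 = vec 0 + vec 1 := by decide

end Literature.NumberTheory.EllipticCurves.DokchitserDokchitser2012

noncomputable section

open scoped Classical

open WeierstrassCurve

namespace Literature.NumberTheory.EllipticCurves.DokchitserDokchitser2012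

universe u

variable {K : Type u} [Field K] (W : WeierstrassCurve K)

/-! ### §2. The `x`-coordinate on `E(K̄)`, the Galois action, and `2`-torsion points -/

/-- The abscissa of a geometric point (`x(O) := 0`, a junk value; bookkeeping only). [folklore] -/
def xco : geomPoints W → AlgebraicClosure K
  | 0 => 0
  | Affine.Point.some x _ _ => x

/-- `x(σP) = σ x(P)`: the Galois action on points is the action on coordinates.
Silverman, *AEC*, VIII.§1. [cite: SilvermanAEC2009, VIII.§1 (G_{K̄/K} acts on E(K̄) coordinatewise)] -/
theorem xco_smul (σ : Field.absoluteGaloisGroup K) (P : geomPoints W) :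
    xco W (σ • P) = σ • xco W P := by
  change (W.baseChange (AlgebraicClosure K)).toAffine.Point at P
  rcases P with _ | ⟨x, y, h⟩
  · change xco W (σ • (0 : geomPoints W)) = σ • (0 : AlgebraicClosure K)
    rw [smul_zero, smul_zero]
    rfl
  · rfl

/-- A point `P ≠ O` with `P + P = O` has its abscissa among the roots of the `2`-division cubic
`4x³ + b₂x² + 2b₄x + b₆` (of the base-changed curve). Silverman, *AEC*, III.§2 (duplication
formula) and Ex. 3.7; tree theorem `isRoot_twoTorsionPolynomial_of_add_self_eq_zero`.
[cite: SilvermanAEC2009, Ex. III.3.7 (d) (ψ₂² = 4x³ + b₂x² + 2b₄x + b₆ vanishes exactly on E[2] ∖ O)] -/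
theorem isRoot_xco_of_add_self_eq_zero {P : geomPoints W} (hP0 : P ≠ 0) (hP : P + P = 0) :
    (W.baseChange (AlgebraicClosure K)).twoTorsionPolynomial.toPoly.IsRoot (xco W P) := by
  change (W.baseChange (AlgebraicClosure K)).toAffine.Point at P
  rcases P with _ | ⟨x, y, h⟩
  · exact absurd rfl hP0
  · exact ((W.baseChange (AlgebraicClosure K)).isRoot_twoTorsionPolynomial_of_add_self_eq_zero hP).2

/-- Two nonzero points with the same abscissa, one of them killed by `2`, are equal (`(x, y)` and
`(x, y')` on the curve are `±` each other, and `-T = T`). Silverman, *AEC*, III.§2.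
[cite: SilvermanAEC2009, III.2.3 (points with equal abscissa are P or −P)] -/
theorem eq_of_xco_eq {P Q : geomPoints W} (hP0 : P ≠ 0) (hQ0 : Q ≠ 0) (hQ : Q + Q = 0)
    (h : xco W P = xco W Q) : P = Q := by
  change (W.baseChange (AlgebraicClosure K)).toAffine.Point at P Q
  rcases P with _ | ⟨x₁, y₁, h₁⟩
  · exact absurd rfl hP0
  rcases Q with _ | ⟨x₂, y₂, h₂⟩
  · exact absurd rfl hQ0
  change x₁ = x₂ at h
  have hnegQ : -(Affine.Point.some x₂ y₂ h₂) = Affine.Point.some x₂ y₂ h₂ := by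
    rw [neg_eq_iff_add_eq_zero]; exact hQ
  rcases (Affine.Point.X_eq_iff (h₁ := h₁) (h₂ := h₂)).mp h with h' | h'
  · exact h'
  · rw [hnegQ] at h'; exact h'

/-- Membership in `E[2]`: `P ∈ E[2] ↔ P + P = O`. [cite: SilvermanAEC2009, III.§6 (definition of E[m])] -/
theorem mem_geomTorsion_two_iff (P : geomPoints W) : P ∈ geomTorsion W 2 ↔ P + P = 0 := by
  rw [show (2 : ℤ) = ((2 : ℕ) : ℤ) from rfl, geomTorsion, AddSubgroup.torsionBy.nsmul_iff,
    two_nsmul]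

/-- An element of `E[2]` is killed by doubling. [cite: SilvermanAEC2009, III.§6 (definition of E[m])] -/
theorem coe_add_self_eq_zero (T : geomTorsion W 2) : (T : geomPoints W) + T = 0 :=
  (mem_geomTorsion_two_iff W T).mp T.2

/-! ### §3. `E[2] ∖ 0 = {T₀, T₁, T₂}`; additive automorphisms of `E[2]` as permutations -/

variable [W.IsElliptic]

/-- A frame `E[2] ≅ ℤ/2 × ℤ/2` (Silverman, *AEC*, Cor. III.6.4(b); tree theorem
`nonempty_geomTorsion_addEquiv_prod`; needs `2 ≠ 0` in `K`). [cite: SilvermanAEC2009, Cor. III.6.4(b)] -/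
def frame (h2 : (2 : K) ≠ 0) : geomTorsion W 2 ≃+ ZMod 2 × ZMod 2 :=
  (nonempty_geomTorsion_addEquiv_prod W (m := 2) (by exact_mod_cast h2)).some

variable (h2 : (2 : K) ≠ 0)

/-- The three nonzero `2`-torsion points `T₀, T₁, T₂ = T₀ + T₁` (in the frame: `(1,0), (0,1),
(1,1)`). Silverman, *AEC*, III.6.4(b). [folklore] -/
def T (i : Fin 3) : geomTorsion W 2 := (frame W h2).symm (vec i)

/-- In the frame, `T_i` is `v_i`. [folklore] -/
private theorem frame_T (i : Fin 3) : frame W h2 (T W h2 i) = vec i := by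
  rw [T, AddEquiv.apply_symm_apply]

/-- `T₀, T₁, T₂` are distinct. Silverman, *AEC*, III.6.4(b).
[cite: SilvermanAEC2009, Cor. III.6.4(b) (E[m] ≅ ℤ/mℤ × ℤ/mℤ)] -/
theorem T_injective : Function.Injective (T W h2) := fun _ _ hij ↦
  vec_injective ((frame W h2).symm.injective hij)

/-- `T_i ≠ O` in `E[2]`. [folklore] -/
private theorem T_ne_zero (i : Fin 3) : T W h2 i ≠ 0 := fun h ↦
  vec_ne_zero i (by rw [← frame_T W h2 i, h, map_zero])

/-- `T_i ≠ O` in `E(K̄)`. [cite: SilvermanAEC2009, Cor. III.6.4(b) (E[m] ≅ ℤ/mℤ × ℤ/mℤ)] -/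
theorem coe_T_ne_zero (i : Fin 3) : (T W h2 i : geomPoints W) ≠ 0 := fun h ↦
  T_ne_zero W h2 i (Subtype.ext h)

/-- `E[2] = {O, T₀, T₁, T₂}`. Silverman, *AEC*, III.6.4(b).
[cite: SilvermanAEC2009, Cor. III.6.4(b) (E[m] ≅ ℤ/mℤ × ℤ/mℤ)] -/
theorem eq_zero_or_eq_T (P : geomTorsion W 2) : P = 0 ∨ ∃ i : Fin 3, P = T W h2 i := by
  rcases eq_zero_or_eq_vec (frame W h2 P) with h | ⟨i, hi⟩
  · exact Or.inl ((frame W h2).injective (by rw [h, map_zero]))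
  · exact Or.inr ⟨i, (frame W h2).injective (by rw [hi, frame_T])⟩

/-- The letter to which an additive automorphism `φ` of `E[2]` sends the letter `i`
(bookkeeping). [folklore] -/
def permFun (φ : geomTorsion W 2 ≃+ geomTorsion W 2) (i : Fin 3) : Fin 3 :=
  idx (frame W h2 (φ (T W h2 i)))

/-- `φ(T_i) = T_{φ(i)}`: an additive automorphism sends `T_i ≠ O` to a nonzero point, i.e. to
some `T_j`. [cite: SilvermanAEC2009, III.§7 (the representation G_{K̄/K} → Aut(E[m]))] -/
private theorem T_permFun (φ : geomTorsion W 2 ≃+ geomTorsion W 2) (i : Fin 3) :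
    T W h2 (permFun W h2 φ i) = φ (T W h2 i) := by
  apply (frame W h2).injective
  rw [frame_T, permFun, vec_idx]
  intro h
  exact T_ne_zero W h2 i (φ.injective (by
    rw [map_zero]; exact (frame W h2).injective (by rw [h, map_zero])))

/-- The induced map on letters is injective (`φ` is). [folklore] -/
private theorem permFun_injective (φ : geomTorsion W 2 ≃+ geomTorsion W 2) :
    Function.Injective (permFun W h2 φ) := fun i j hij ↦ by
  apply T_injective W h2
  apply φ.injective
  rw [← T_permFun, ← T_permFun, hij]

/-- **An additive automorphism of `E[2]` is a permutation of `{T₀, T₁, T₂}`.** [folklore] -/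
def perm (φ : geomTorsion W 2 ≃+ geomTorsion W 2) : Equiv.Perm (Fin 3) :=
  Equiv.ofBijective (permFun W h2 φ) (permFun_injective W h2 φ).bijective_of_finite

/-- `φ(T_i) = T_{perm φ i}`.
[cite: SilvermanAEC2009, III.§7 (the representation G_{K̄/K} → Aut(E[m]))] -/
theorem T_perm (φ : geomTorsion W 2 ≃+ geomTorsion W 2) (i : Fin 3) :
    T W h2 (perm W h2 φ i) = φ (T W h2 i) :=
  T_permFun W h2 φ i

/-- Two permutations agreeing letter-by-letter on the `T_i` are equal. [folklore] -/
private theorem perm_ext {p q : Equiv.Perm (Fin 3)} (h : ∀ i, T W h2 (p i) = T W h2 (q i)) : p = q :=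
  Equiv.ext fun i ↦ T_injective W h2 (h i)

/-- `perm` is injective: an automorphism of `E[2]` is determined by the induced permutation
(`E[2] = {O, T₀, T₁, T₂}`). [cite: SilvermanAEC2009, III.§7 (the representation G_{K̄/K} → Aut(E[m]))] -/
theorem perm_injective {φ ψ : geomTorsion W 2 ≃+ geomTorsion W 2}
    (h : perm W h2 φ = perm W h2 ψ) : φ = ψ := by
  refine AddEquiv.ext fun P ↦ ?_
  rcases eq_zero_or_eq_T W h2 P with rfl | ⟨i, rfl⟩
  · rw [map_zero, map_zero]
  · rw [← T_perm W h2 φ, ← T_perm W h2 ψ, h]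

/-- The additive automorphism `ρ̄₂(σ)` of `E[2]` given by `σ ∈ Γ_K` (bookkeeping for
`galoisRepTorsion`). Silverman, *AEC*, III.§7. [folklore] -/
def rho (σ : Field.absoluteGaloisGroup K) : geomTorsion W 2 ≃+ geomTorsion W 2 :=
  (galoisRepTorsion W 2 σ).toAdd

omit [W.IsElliptic] in
/-- `ρ̄₂(σ) P = σP`. Silverman, *AEC*, III.§7.
[cite: SilvermanAEC2009, III.§7 (the representation G_{K̄/K} → Aut(E[m]))] -/
@[simp]
theorem rho_apply (σ : Field.absoluteGaloisGroup K) (P : geomTorsion W 2) : rho W σ P = σ • P :=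
  galoisRepTorsion_apply W 2 σ P

/-- The permutation of `{T₀, T₁, T₂}` induced by `σ ∈ Γ_K`. Silverman, *AEC*, III.§7. [folklore] -/
def permGal (σ : Field.absoluteGaloisGroup K) : Equiv.Perm (Fin 3) :=
  perm W h2 (rho W σ)

/-- `σ T_i = T_{σ(i)}` in `E[2]`.
[cite: SilvermanAEC2009, III.§7 (the representation G_{K̄/K} → Aut(E[m]))] -/
theorem T_permGal (σ : Field.absoluteGaloisGroup K) (i : Fin 3) :
    T W h2 (permGal W h2 σ i) = σ • T W h2 i := by
  rw [permGal, T_perm, rho_apply]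

/-- `σ T_i = T_{σ(i)}` in `E(K̄)`.
[cite: SilvermanAEC2009, III.§7 (the representation G_{K̄/K} → Aut(E[m]))] -/
theorem coe_T_permGal (σ : Field.absoluteGaloisGroup K) (i : Fin 3) :
    (T W h2 (permGal W h2 σ i) : geomPoints W) = σ • (T W h2 i : geomPoints W) := by
  rw [T_permGal, AddSubgroup.torsionBy.coe_smul]

/-- `σ ↦ permGal σ` is multiplicative.
[cite: SilvermanAEC2009, III.§7 (the representation G_{K̄/K} → Aut(E[m]))] -/
theorem permGal_mul (σ τ : Field.absoluteGaloisGroup K) :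
    permGal W h2 (σ * τ) = permGal W h2 σ * permGal W h2 τ :=
  perm_ext W h2 fun i ↦ by
    rw [T_permGal, Equiv.Perm.mul_apply, T_permGal, T_permGal, mul_smul]

/-- The identity of `Γ_K` induces the identity permutation.
[cite: SilvermanAEC2009, III.§7 (the representation G_{K̄/K} → Aut(E[m]))] -/
theorem permGal_one : permGal W h2 1 = 1 :=
  perm_ext W h2 fun i ↦ by rw [T_permGal, one_smul, Equiv.Perm.one_apply]

/-! ### §3b. The abscissae `x_i = x(T_i)` -/

/-- `x_i = x(T_i)`. [folklore] -/
def xT (i : Fin 3) : AlgebraicClosure K := xco W (T W h2 i : geomPoints W)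

/-- `x₀, x₁, x₂` are distinct (a `2`-torsion point is determined by its abscissa). Silverman,
*AEC*, III.§2. [cite: SilvermanAEC2009, III.2.3 (points with equal abscissa are P or −P)] -/
theorem xT_injective : Function.Injective (xT W h2) := fun i j hij ↦
  T_injective W h2 (Subtype.ext (eq_of_xco_eq W (coe_T_ne_zero W h2 i) (coe_T_ne_zero W h2 j)
    (coe_add_self_eq_zero W _) hij))

/-- `σ x_i = x_{σ(i)}`. [cite: SilvermanAEC2009, VIII.§1 (G_{K̄/K} acts on E(K̄) coordinatewise)] -/
theorem smul_xT (σ : Field.absoluteGaloisGroup K) (i : Fin 3) :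
    σ • xT W h2 i = xT W h2 (permGal W h2 σ i) := by
  rw [xT, xT, coe_T_permGal, xco_smul]

/-! ### §3c. Two explicit automorphisms of `E[2]` -/

/-- The coordinate swap of `(ℤ/2)²`, transported to `E[2]`: the automorphism `T₀ ↔ T₁`,
`T₂ ↦ T₂`. [folklore] -/
def swapAut : geomTorsion W 2 ≃+ geomTorsion W 2 :=
  (frame W h2).trans (AddEquiv.prodComm.trans (frame W h2).symm)

/-- `swapAut` on the letters: `T₀ ↔ T₁`, `T₂ ↦ T₂`. [folklore] -/
private theorem swapAut_T (i : Fin 3) : swapAut W h2 (T W h2 i) = T W h2 (Equiv.swap 0 1 i) := by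
  apply (frame W h2).injective
  rw [frame_T, swapAut, AddEquiv.trans_apply, AddEquiv.trans_apply, AddEquiv.apply_symm_apply,
    frame_T]
  revert i
  decide

/-- `swapAut` induces the transposition `(0 1)`.
[cite: SilvermanAEC2009, Cor. III.6.4(b) (E[m] ≅ ℤ/mℤ × ℤ/mℤ)] -/
theorem perm_swapAut : perm W h2 (swapAut W h2) = Equiv.swap 0 1 :=
  perm_ext W h2 fun i ↦ by rw [T_perm, swapAut_T]

/-- The shear `(a, b) ↦ (a, a + b)` of `(ℤ/2)²` (an involution). [folklore] -/
def shear : ZMod 2 × ZMod 2 ≃+ ZMod 2 × ZMod 2 where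
  toFun w := (w.1, w.1 + w.2)
  invFun w := (w.1, w.1 + w.2)
  left_inv w := by obtain ⟨a, b⟩ := w; revert a b; decide
  right_inv w := by obtain ⟨a, b⟩ := w; revert a b; decide
  map_add' := fun ⟨a, b⟩ ⟨a', b'⟩ ↦ Prod.ext rfl (add_add_add_comm a a' b b')

/-- The shear transported to `E[2]`: `T₀ ↦ T₂`, `T₁ ↦ T₁`, `T₂ ↦ T₀`. [folklore] -/
def shearAut : geomTorsion W 2 ≃+ geomTorsion W 2 :=
  (frame W h2).trans (shear.trans (frame W h2).symm)

/-- `shearAut` on the letters: `T₀ ↔ T₂`, `T₁ ↦ T₁`. [folklore] -/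
private theorem shearAut_T (i : Fin 3) : shearAut W h2 (T W h2 i) = T W h2 (Equiv.swap 0 2 i) := by
  apply (frame W h2).injective
  rw [frame_T, shearAut, AddEquiv.trans_apply, AddEquiv.trans_apply, AddEquiv.apply_symm_apply,
    frame_T]
  revert i
  decide

include h2 in
/-- Every nonzero `Q ∈ E[2]` is moved by some additive automorphism of `E[2]`.
[cite: SilvermanAEC2009, Cor. III.6.4(b) (E[m] ≅ ℤ/mℤ × ℤ/mℤ)] -/
theorem exists_addEquiv_apply_ne {Q : geomTorsion W 2} (hQ : Q ≠ 0) :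
    ∃ φ : geomTorsion W 2 ≃+ geomTorsion W 2, φ Q ≠ Q := by
  rcases eq_zero_or_eq_T W h2 Q with rfl | ⟨i, rfl⟩
  · exact absurd rfl hQ
  fin_cases i
  · exact ⟨swapAut W h2, by rw [swapAut_T]; exact (T_injective W h2).ne (by decide)⟩
  · exact ⟨swapAut W h2, by rw [swapAut_T]; exact (T_injective W h2).ne (by decide)⟩
  · exact ⟨shearAut W h2, by rw [shearAut_T]; exact (T_injective W h2).ne (by decide)⟩

/-! ### §3d. `δ = ∏_{i<j} (x_i - x_j)` and `σ δ = sign(σ) δ` -/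

/-- `δ = (x₀ - x₁)(x₀ - x₂)(x₁ - x₂)`, a square root of `Δ/16`. [folklore] -/
def delta : AlgebraicClosure K :=
  (xT W h2 0 - xT W h2 1) * (xT W h2 0 - xT W h2 2) * (xT W h2 1 - xT W h2 2)

/-- `δ ≠ 0` (the `x_i` are distinct).
[cite: SilvermanAEC2009, III.2.3 (points with equal abscissa are P or −P)] -/
theorem delta_ne_zero : delta W h2 ≠ 0 :=
  mul_ne_zero (mul_ne_zero (sub_ne_zero.mpr ((xT_injective W h2).ne (by decide)))
    (sub_ne_zero.mpr ((xT_injective W h2).ne (by decide))))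
    (sub_ne_zero.mpr ((xT_injective W h2).ne (by decide)))

omit [W.IsElliptic] in
/-- Permuting three letters changes `∏_{i<j} (x_i - x_j)` by the sign. [folklore] -/
private theorem prod_sub_perm (x : Fin 3 → AlgebraicClosure K) (p : Equiv.Perm (Fin 3)) :
    (x (p 0) - x (p 1)) * (x (p 0) - x (p 2)) * (x (p 1) - x (p 2)) =
      ((Equiv.Perm.sign p : ℤ) : AlgebraicClosure K) *
        ((x 0 - x 1) * (x 0 - x 2) * (x 1 - x 2)) := by
  have h01 : (0 : Fin 3) ≠ 1 := by decide
  have h02 : (0 : Fin 3) ≠ 2 := by decide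
  have h12 : (1 : Fin 3) ≠ 2 := by decide
  rcases perm_three_cases p with rfl | rfl | rfl | rfl | rfl | rfl
  · simp
  · rw [Equiv.Perm.sign_swap h01]; simp [Equiv.swap_apply_def]; ring
  · rw [Equiv.Perm.sign_swap h02]; simp [Equiv.swap_apply_def]; ring
  · rw [Equiv.Perm.sign_swap h12]; simp [Equiv.swap_apply_def]; ring
  · rw [Equiv.Perm.sign_mul, Equiv.Perm.sign_swap h01, Equiv.Perm.sign_swap h02]
    simp [Equiv.swap_apply_def, Equiv.Perm.mul_apply]; ring
  · rw [Equiv.Perm.sign_mul, Equiv.Perm.sign_swap h01, Equiv.Perm.sign_swap h02]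
    simp [Equiv.swap_apply_def, Equiv.Perm.mul_apply]; ring

/-- `σ δ = sign(σ) · δ` (Dokchitser–Dokchitser, proof: "`ℚ(E[2]) ⊃ ℚ(√Δ)`").
[cite: DokchitserDokchitserMathZ2012, Theorem (1), proof (ℚ(E[2]) ⊃ ℚ(√Δ))] -/
theorem smul_delta (σ : Field.absoluteGaloisGroup K) :
    σ • delta W h2 = ((Equiv.Perm.sign (permGal W h2 σ) : ℤ) : AlgebraicClosure K) * delta W h2 := by
  simp only [delta, smul_mul', smul_sub, smul_xT]
  exact prod_sub_perm (xT W h2) (permGal W h2 σ)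

end Literature.NumberTheory.EllipticCurves.DokchitserDokchitser2012

end
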